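import Summits.ResolutionOfSingularities.ResolutionOfSingularities.Theorems.HomologicalConductorNoZenoTraceSocleTerminator
import Summits.ResolutionOfSingularities.ResolutionOfSingularities.Theorems.FrobeniusClosingSteerHironakaLUBranchOfCPPrelims
import HarnessLib

/-!
# Crux `NoZenoR` / `NoZeno` (stmt-ResolutionOfSingularities-19943 / -16483), β1 layer:
# TRACE-SOCLE — residual images of the stages in `κ(W)`, unit lifting, Chevalley in `κ(W)`, the trace field
# (port of res-L0-w44-idea-1's Sketch r12 §r12.2, §r12.3, §r12.5)

`[OURS · L W4.4]` Tree port (seat res-L0-w44-stub-1 g8, CHAIN v20 (ρ34e)) of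
`L/res-L0-w44-idea-1/Sketch-idea-1-r12.lean` (sha16 `4a9f7a6f66dee56f`), AUTHOR res-L0-w44-idea-1; statements and
proofs are the ideator's, DEF-FREE: the sketch's `resImage W T` is spelled
`((residue W).comp (Subring.inclusion hTW : T →+* W)).range` (the residual image `T / (T ∩ 𝔪_W) ⊆ κ(W)`) and its
`traceField W T` is spelled `IntermediateField.adjoin k (Set.range fun x : T => residue W ⟨x, _⟩)` (the subfield
of `κ(W)` generated over `k` by the residues of `T`).  Nothing here is a statement of the manuscript under review
(Hironaka 2017); AI-written, weaker than expert review; support-level, counted 0.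

* `mem_resRange_iff`, `residue_mem_resRange`, `isLocalRing_resRange`, `coe_resRange` — the residual image.
* `inv_mem_of_residue_mul_eq_one` — UNIT LIFTING (the one place where `O` and `W` talk): `T ⊆ O ∩ W` inverting
  its `O`-units, `s, b ∈ T` with `res_W(s)·res_W(b) = 1` ⇒ `s` is an `O`-unit.
* `resRange_dominates` — for stages `T ≤ T'` the residual image of `T'` dominates that of `T`.
* `exists_traceDominator` — CHEVALLEY IN `κ(W)`: a valuation ring `Ū` of `κ(W)` containing all stage residues and
  dominating the residual union (tree `SwitchingDichotomy.HironakaLUBranchOfCP.exists_valuationSubring_dominates`).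
* `residue_mem_traceField_of_mem_loc`, `residue_mem_adjoin_of_mem_adjoin`, `traceField_fg`, `traceField_top_fg`,
  `trdeg_traceField_le` — the trace field: confined residues live in it; it is finitely generated over `k` as soon
  as `T` is essentially of finite type (even for DEFECT `W`); its transcendence degree is at most that of `κ(W)`.

References: C. Chevalley's extension theorem (via the tree); O. Zariski, P. Samuel, *Commutative Algebra* II (1960)
VI [`ZariskiSamuel1960`] (residue fields of valuation rings; background only).
-/

noncomputable section

-- single-problem summit: the doubled namespace component `ResolutionOfSingularities` is forced
set_option linter.dupNamespace false

namespace Summit.ResolutionOfSingularities.ResolutionOfSingularities.Theorems.NoZeno.TraceSocle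

open Summit.ResolutionOfSingularities.ResolutionOfSingularities.Theses.HomologicalConductor
open Summit.ResolutionOfSingularities.ResolutionOfSingularities.Theorems.NoZeno.Birth
open Summit.ResolutionOfSingularities.ResolutionOfSingularities.Theorems.NoZeno.SandwichCluster.Parasite
open Summit.ResolutionOfSingularities.ResolutionOfSingularities.Theorems
open Summit.ResolutionOfSingularities.ResolutionOfSingularities.Theorems.NoZeno
open Literature.AlgebraicGeometry.Resolution
open IsLocalRing

variable {k K : Type} [Field k] [Field K] [Algebra k K]

/-! ## §r12.2 Residual images of the stages in `κ(W)` -/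

/-- Membership in the residual image `res_W(T) = T / (T ∩ 𝔪_W) ⊆ κ(W)` of `T ⊆ W`. [folklore] -/
theorem mem_resRange_iff (W : ValuationSubring K) (T : Subalgebra k K) (hTW : T.toSubring ≤ W.toSubring)
    (r : ResidueField W) :
    r ∈ ((residue W).comp (Subring.inclusion hTW : ↥T →+* ↥W)).range ↔
      ∃ s : K, ∃ hs : s ∈ T, residue W ⟨s, hTW hs⟩ = r := by
  constructor
  · rintro ⟨x, rfl⟩
    exact ⟨x, x.2, rfl⟩
  · rintro ⟨s, hs, rfl⟩
    exact ⟨⟨s, hs⟩, rfl⟩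

/-- Residues of elements of `T` lie in the residual image. [folklore] -/
theorem residue_mem_resRange (W : ValuationSubring K) (T : Subalgebra k K) (hTW : T.toSubring ≤ W.toSubring)
    {s : K} (hs : s ∈ T) :
    residue W ⟨s, hTW hs⟩ ∈ ((residue W).comp (Subring.inclusion hTW : ↥T →+* ↥W)).range :=
  (mem_resRange_iff W T hTW _).2 ⟨s, hs, rfl⟩

/-- The residual image, as a set, is the range of the residue map on `T`. [folklore] -/
theorem coe_resRange (W : ValuationSubring K) (T : Subalgebra k K) (hTW : T.toSubring ≤ W.toSubring) :
    (((residue W).comp (Subring.inclusion hTW : ↥T →+* ↥W)).range : Set (ResidueField W)) =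
      Set.range fun x : ↥T => residue W ⟨(x : K), hTW x.2⟩ := by
  ext r
  rw [SetLike.mem_coe, mem_resRange_iff, Set.mem_range]
  constructor
  · rintro ⟨s, hs, rfl⟩; exact ⟨⟨s, hs⟩, rfl⟩
  · rintro ⟨x, rfl⟩; exact ⟨x, x.2, rfl⟩

/-- The residual image of a LOCAL `T` is local. [folklore] -/
theorem isLocalRing_resRange (W : ValuationSubring K) (T : Subalgebra k K) (hTW : T.toSubring ≤ W.toSubring)
    [IsLocalRing ↥T] : IsLocalRing ↥((residue W).comp (Subring.inclusion hTW : ↥T →+* ↥W)).range :=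
  IsLocalRing.of_surjective' ((residue W).comp (Subring.inclusion hTW : ↥T →+* ↥W)).rangeRestrict
    ((residue W).comp (Subring.inclusion hTW : ↥T →+* ↥W)).rangeRestrict_surjective

/-! ## The unit-lifting lemma and residual domination -/

/-- **UNIT-LIFTING LEMMA (PROVED; the one place where `O` and `W` talk to each other).**  Let `T ⊆ O ∩ W` invert
its `O`-units.  If `s, b ∈ T` have `res_W(s)·res_W(b) = 1`, then `s` is an `O`-unit.  [Else `s·b ∈ 𝔪_O`, so
`1 - s·b` is an `O`-unit of `T`, hence inverted in `T ⊆ W`; but `res_W(1 - s·b) = 0`.]  No comparability of `O`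
and `W` is needed. [this work] -/
theorem inv_mem_of_residue_mul_eq_one (O W : ValuationSubring K) (T : Subalgebra k K)
    (hTW : ∀ x ∈ T, x ∈ W) (hTO : ∀ x ∈ T, x ∈ O) (hinv : ∀ x ∈ T, x⁻¹ ∈ O → x⁻¹ ∈ T)
    {s b : K} (hs : s ∈ T) (hb : b ∈ T)
    (h1 : residue W ⟨s, hTW s hs⟩ * residue W ⟨b, hTW b hb⟩ = 1) : s⁻¹ ∈ O := by
  by_contra hsO
  have hsb : s * b ∈ T := T.mul_mem hs hb
  have hd : 1 - s * b ∈ T := T.sub_mem T.one_mem hsb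
  -- `s` is a non-unit of `O`, hence so is `s * b`, hence `1 - s * b` is an `O`-unit
  have hsmax : (⟨s, hTO s hs⟩ : O) ∈ maximalIdeal O := by
    rw [mem_maximalIdeal, mem_nonunits_iff]
    exact fun hu => hsO (inv_mem_of_isUnit O (hTO s hs) hu)
  have hsbmax : (⟨s * b, hTO _ hsb⟩ : O) ∈ maximalIdeal O := by
    have e : (⟨s * b, hTO _ hsb⟩ : O) = ⟨b, hTO b hb⟩ * ⟨s, hTO s hs⟩ := Subtype.ext (mul_comm s b)
    rw [e]; exact Ideal.mul_mem_left _ _ hsmax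
  have hu : IsUnit (⟨1 - s * b, hTO _ hd⟩ : O) := by
    have e : (⟨1 - s * b, hTO _ hd⟩ : O) = 1 - ⟨s * b, hTO _ hsb⟩ := Subtype.ext rfl
    rw [e]
    exact isUnit_one_sub_self_of_mem_nonunits _ ((mem_maximalIdeal _).mp hsbmax)
  have hdiO : (1 - s * b)⁻¹ ∈ O := inv_mem_of_isUnit O (hTO _ hd) hu
  have hdiT : (1 - s * b)⁻¹ ∈ T := hinv _ hd hdiO
  have hdiW : (1 - s * b)⁻¹ ∈ W := hTW _ hdiT
  -- but `res_W (1 - s * b) = 0`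
  have hres : residue W ⟨1 - s * b, hTW _ hd⟩ = 0 := by
    have e : (⟨1 - s * b, hTW _ hd⟩ : W) = 1 - ⟨s, hTW s hs⟩ * ⟨b, hTW b hb⟩ := Subtype.ext rfl
    rw [e, map_sub, map_one, map_mul, h1, sub_self]
  have hd0 : 1 - s * b ≠ 0 := by
    intro h
    have hsb1 : s * b = 1 := (sub_eq_zero.mp h).symm
    have : IsUnit (⟨s * b, hTO _ hsb⟩ : O) := by
      have e : (⟨s * b, hTO _ hsb⟩ : O) = 1 := Subtype.ext hsb1
      rw [e]; exact isUnit_one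
    exact (mem_nonunits_iff.mp ((mem_maximalIdeal _).mp hsbmax)) this
  have huW : IsUnit (⟨1 - s * b, hTW _ hd⟩ : W) := isUnit_of_inv_mem W (hTW _ hd) hdiW hd0
  have hnu : (⟨1 - s * b, hTW _ hd⟩ : W) ∈ maximalIdeal W := (residue_eq_zero_iff _).mp hres
  exact (mem_nonunits_iff.mp ((mem_maximalIdeal _).mp hnu)) huW

/-- **RESIDUAL DOMINATION.**  For stages `T ≤ T'` inside `O ∩ W`, both inverting their `O`-units, the residual
image of `T'` dominates that of `T` in `κ(W)`. [this work] -/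
theorem resRange_dominates (O W : ValuationSubring K) (T T' : Subalgebra k K) (hTT' : T ≤ T')
    (hTW : T.toSubring ≤ W.toSubring) (hT'W : T'.toSubring ≤ W.toSubring)
    (hT'O : ∀ x ∈ T', x ∈ O) (hinv : ∀ x ∈ T, x⁻¹ ∈ O → x⁻¹ ∈ T) (hinv' : ∀ x ∈ T', x⁻¹ ∈ O → x⁻¹ ∈ T') :
    SubringDominates ((residue W).comp (Subring.inclusion hTW : ↥T →+* ↥W)).range
      ((residue W).comp (Subring.inclusion hT'W : ↥T' →+* ↥W)).range := by
  refine ⟨?_, ?_⟩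
  · intro r hr
    obtain ⟨s, hs, rfl⟩ := (mem_resRange_iff W T hTW r).1 hr
    exact (mem_resRange_iff W T' hT'W _).2 ⟨s, hTT' hs, rfl⟩
  · intro r hr hri
    obtain ⟨s, hs, rfl⟩ := (mem_resRange_iff W T hTW r).1 hr
    rcases eq_or_ne (residue W ⟨s, hTW hs⟩) 0 with h0 | h0
    · rw [h0, inv_zero]; exact Subring.zero_mem _
    obtain ⟨b, hb, hbe⟩ := (mem_resRange_iff W T' hT'W _).1 hri
    have hs0 : s ≠ 0 := by
      rintro rfl
      apply h0
      have e : (⟨(0 : K), hTW hs⟩ : W) = 0 := Subtype.ext rfl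
      rw [e, map_zero]
    have h1 : residue W ⟨s, hT'W (hTT' hs)⟩ * residue W ⟨b, hT'W hb⟩ = 1 := by
      rw [hbe]; exact mul_inv_cancel₀ h0
    have hsO : s⁻¹ ∈ O :=
      inv_mem_of_residue_mul_eq_one O W T' (fun x hx => hT'W hx) hT'O hinv' (hTT' hs) hb h1
    have hsT : s⁻¹ ∈ T := hinv s hs hsO
    refine (mem_resRange_iff W T hTW _).2 ⟨s⁻¹, hsT, ?_⟩
    exact residue_mk_inv W (hTW hs) (hTW hsT) hs0

/-! ## §r12.3 Chevalley in `κ(W)`: a TRACE DOMINATOR `Ū` exists -/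

/-- **TRACE DOMINATOR.**  If every stage lies in `W`, some valuation ring `Ū` of `κ(W)` contains every stage
residue and DOMINATES the residual union: a stage element that is a `W`-unit with `Ū`-unit residue is an `O`-unit.
[Chevalley along the branch `S_m = res_W(T_m)` of local subrings of `κ(W)` (`resRange_dominates`), then the
unit-lifting lemma.] [this work] -/
theorem exists_traceDominator (O : ValuationSubring K) (A : Subalgebra k K)
    (hk : ∀ c : k, algebraMap k K c ∈ O) (hAO : A.toSubring ≤ O.toSubring)
    (W : ValuationSubring K) (hW : ∀ m : ℕ, ∀ s ∈ tower O A m, s ∈ W) :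
    ∃ Ū : ValuationSubring (ResidueField W),
      (∀ (m : ℕ) (s : K) (hs : s ∈ tower O A m), residue W ⟨s, hW m s hs⟩ ∈ Ū) ∧
      (∀ (m : ℕ) (s : K) (hs : s ∈ tower O A m), s⁻¹ ∈ W →
        (residue W ⟨s, hW m s hs⟩)⁻¹ ∈ Ū → s⁻¹ ∈ O) := by
  have hTO : ∀ m, ∀ x ∈ tower O A m, x ∈ O := stage_le O A hk hAO
  have hinv : ∀ m, ∀ s ∈ tower O A m, s⁻¹ ∈ O → s⁻¹ ∈ tower O A m := inv_mem_stage O A hk hAO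
  have hW' : ∀ m, (tower O A m).toSubring ≤ W.toSubring := fun m x hx => hW m x hx
  let S : ℕ → Subring (ResidueField W) := fun m =>
    ((residue W).comp (Subring.inclusion (hW' m) : ↥(tower O A m) →+* ↥W)).range
  have hSloc : ∀ m, IsLocalRing ↥(S m) := fun m => by
    haveI : IsLocalRing ↥(tower O A m) := by
      obtain ⟨B, hBO, hTB⟩ := exists_tower_eq_loc O A hk hAO m
      rw [hTB, loc_eq_locAt]
      exact SyzygyFlattening.isLocalRing_locAt O B hBO
    exact isLocalRing_resRange W (tower O A m) (hW' m)
  have hdom : ∀ m, SubringDominates (S m) (S (m + 1)) := fun m =>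
    resRange_dominates O W (tower O A m) (tower O A (m + 1))
      (fun _ hx => d2rc_mem_tower_of_le O A (Nat.le_succ m) hx)
      (hW' m) (hW' (m + 1)) (hTO (m + 1)) (hinv m) (hinv (m + 1))
  obtain ⟨Ū, hŪ⟩ :=
    @SwitchingDichotomy.HironakaLUBranchOfCP.exists_valuationSubring_dominates (ResidueField W) _ S hSloc hdom
  refine ⟨Ū, fun m s hs => (hŪ m).1 (residue_mem_resRange W _ (hW' m) hs), fun m s hs hsW hsU => ?_⟩
  rcases eq_or_ne s 0 with rfl | hs0
  · rw [inv_zero]; exact O.zero_mem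
  have h0 : residue W ⟨s, hW m s hs⟩ ≠ 0 := residue_ne_zero_of_inv_mem W (hW m s hs) hsW hs0
  have hri : (residue W ⟨s, hW m s hs⟩)⁻¹ ∈ S m := (hŪ m).2 _ (residue_mem_resRange W _ (hW' m) hs) hsU
  obtain ⟨b, hb, hbe⟩ := (mem_resRange_iff W _ (hW' m) _).1 hri
  have h1 : residue W ⟨s, hW m s hs⟩ * residue W ⟨b, hW m b hb⟩ = 1 := by
    rw [hbe]; exact mul_inv_cancel₀ h0
  exact inv_mem_of_residue_mul_eq_one O W (tower O A m) (hW m) (hTO m) (hinv m) hs hb h1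

/-! ## §r12.5 The TRACE FIELD `k(res_W T)` -/


/-- **CONFINED RESIDUES LIVE IN THE TRACE FIELD (PROVED).**  Every element of `loc W T` is in `W` and has residue
in `k(res_W T)`. [this work] -/
theorem residue_mem_traceField_of_mem_loc (W : ValuationSubring K) [Algebra k W] [IsScalarTower k W K]
    (T : Subalgebra k K) (hTW : ∀ x ∈ T, x ∈ W) {x : K} (hx : x ∈ loc W T) :
    ∃ hxW : x ∈ W, residue W ⟨x, hxW⟩ ∈ IntermediateField.adjoin k (Set.range fun x : ↥T => residue W ⟨(x : K), hTW x x.2⟩) := by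
  change x ∈ Algebra.adjoin k {y : K | ∃ a ∈ T, ∃ s ∈ T, s⁻¹ ∈ W ∧ y = a * s⁻¹} at hx
  induction hx using Algebra.adjoin_induction with
  | mem y hy =>
    obtain ⟨a, ha, s, hs, hsi, rfl⟩ := hy
    refine ⟨W.mul_mem _ _ (hTW a ha) hsi, ?_⟩
    rcases eq_or_ne s 0 with rfl | hs0
    · have e : (⟨a * (0 : K)⁻¹, W.mul_mem _ _ (hTW a ha) hsi⟩ : W) = 0 := Subtype.ext (by simp)
      rw [e, map_zero]; exact (IntermediateField.adjoin k (Set.range fun x : ↥T => residue W ⟨(x : K), hTW x x.2⟩)).zero_mem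
    rw [residue_mul_inv W (hTW a ha) (hTW s hs) hsi hs0]
    exact (IntermediateField.adjoin k (Set.range fun x : ↥T => residue W ⟨(x : K), hTW x x.2⟩)).mul_mem
      (IntermediateField.subset_adjoin k _ ⟨⟨a, ha⟩, rfl⟩)
      ((IntermediateField.adjoin k (Set.range fun x : ↥T => residue W ⟨(x : K), hTW x x.2⟩)).inv_mem (IntermediateField.subset_adjoin k _ ⟨⟨s, hs⟩, rfl⟩))
  | algebraMap c =>
    refine ⟨algebraMap_mem_of_isScalarTower W c, ?_⟩
    have e : (⟨algebraMap k K c, algebraMap_mem_of_isScalarTower W c⟩ : W) = algebraMap k W c :=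
      Subtype.ext (IsScalarTower.algebraMap_apply k W K c)
    rw [e, ← ResidueField.algebraMap_eq, ← IsScalarTower.algebraMap_apply k W (ResidueField W) c]
    exact (IntermediateField.adjoin k (Set.range fun x : ↥T => residue W ⟨(x : K), hTW x x.2⟩)).algebraMap_mem c
  | add y y' hy hy' ih ih' =>
    obtain ⟨h1, hF1⟩ := ih
    obtain ⟨h2, hF2⟩ := ih'
    refine ⟨W.add_mem _ _ h1 h2, ?_⟩
    have e : (⟨y + y', W.add_mem _ _ h1 h2⟩ : W) = ⟨y, h1⟩ + ⟨y', h2⟩ := Subtype.ext rfl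
    rw [e, map_add]; exact (IntermediateField.adjoin k (Set.range fun x : ↥T => residue W ⟨(x : K), hTW x x.2⟩)).add_mem hF1 hF2
  | mul y y' hy hy' ih ih' =>
    obtain ⟨h1, hF1⟩ := ih
    obtain ⟨h2, hF2⟩ := ih'
    refine ⟨W.mul_mem _ _ h1 h2, ?_⟩
    have e : (⟨y * y', W.mul_mem _ _ h1 h2⟩ : W) = ⟨y, h1⟩ * ⟨y', h2⟩ := Subtype.ext rfl
    rw [e, map_mul]; exact (IntermediateField.adjoin k (Set.range fun x : ↥T => residue W ⟨(x : K), hTW x x.2⟩)).mul_mem hF1 hF2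

/-- Residues of the elements of a subalgebra `k[σ] ⊆ T` lie in `k(res_W σ)`. [folklore] -/
theorem residue_mem_adjoin_of_mem_adjoin (W : ValuationSubring K) [Algebra k W] [IsScalarTower k W K]
    (T : Subalgebra k K) (hTW : ∀ x ∈ T, x ∈ W) (σ : Set ↥T) {y : ↥T}
    (hy : y ∈ Algebra.adjoin k σ) :
    residue W ⟨(y : K), hTW y y.2⟩ ∈
      IntermediateField.adjoin k ((fun x : ↥T => residue W ⟨(x : K), hTW x x.2⟩) '' σ) := by
  induction hy using Algebra.adjoin_induction with
  | mem y hy => exact IntermediateField.subset_adjoin k _ ⟨y, hy, rfl⟩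
  | algebraMap c =>
    have e : (⟨((algebraMap k ↥T c : ↥T) : K), hTW _ (algebraMap k ↥T c).2⟩ : W) = algebraMap k W c :=
      Subtype.ext (by
        rw [Subalgebra.coe_algebraMap, IsScalarTower.algebraMap_apply k (↥W) K c]
        rfl)
    rw [e, ← ResidueField.algebraMap_eq, ← IsScalarTower.algebraMap_apply k W (ResidueField W) c]
    exact (IntermediateField.adjoin k _).algebraMap_mem c
  | add y y' hy hy' ih ih' =>
    have e : (⟨((y + y' : ↥T) : K), hTW _ (y + y').2⟩ : W) =
        ⟨(y : K), hTW y y.2⟩ + ⟨(y' : K), hTW y' y'.2⟩ := Subtype.ext rfl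
    rw [e, map_add]; exact (IntermediateField.adjoin k _).add_mem ih ih'
  | mul y y' hy hy' ih ih' =>
    have e : (⟨((y * y' : ↥T) : K), hTW _ (y * y').2⟩ : W) =
        ⟨(y : K), hTW y y.2⟩ * ⟨(y' : K), hTW y' y'.2⟩ := Subtype.ext rfl
    rw [e, map_mul]; exact (IntermediateField.adjoin k _).mul_mem ih ih'

/-- **THE TRACE FIELD OF AN ESSENTIALLY-FINITE-TYPE STAGE IS FINITELY GENERATED (PROVED).**  If `T = k[σ]_S`
is essentially of finite type over `k` (every stage is: tree `tn_tower_invariant`), then `k(res_W T) = k(res_W σ)`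
is a finitely generated subextension of `κ(W)/k` — even when `κ(W)` itself is NOT finitely generated over `k`
(defect). [this work] -/
theorem traceField_fg (W : ValuationSubring K) [Algebra k W] [IsScalarTower k W K]
    (T : Subalgebra k K) (hTW : ∀ x ∈ T, x ∈ W) [hT : Algebra.EssFiniteType k ↥T] :
    (IntermediateField.adjoin k (Set.range fun x : ↥T => residue W ⟨(x : K), hTW x x.2⟩)).FG := by
  classical
  obtain ⟨σ, hσ⟩ := (Algebra.essFiniteType_iff (R := k) (S := ↥T)).mp hT
  let ρ : ↥T → ResidueField W := fun x => residue W ⟨(x : K), hTW x x.2⟩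
  refine ⟨σ.image ρ, ?_⟩
  rw [Finset.coe_image]
  refine le_antisymm ?_ ?_
  · rw [IntermediateField.adjoin_le_iff]
    rintro r ⟨x, -, rfl⟩
    exact IntermediateField.subset_adjoin k _ ⟨x, rfl⟩
  · rw [IntermediateField.adjoin_le_iff]
    rintro r ⟨⟨s, hs⟩, rfl⟩
    change residue W ⟨s, hTW s hs⟩ ∈ _
    obtain ⟨t, ht, htu, hst⟩ := hσ ⟨s, hs⟩
    -- `t` is a unit of `T`: its inverse lies in `T ⊆ W`, so `res_W t ≠ 0`
    have ht0K : ((t : ↥T) : K) ≠ 0 := fun h => htu.ne_zero (Subtype.ext h)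
    have htinv : ((t : ↥T) : K)⁻¹ ∈ T := by
      obtain ⟨u, hu⟩ := htu
      have h1 : (((u⁻¹ : (↥T)ˣ) : ↥T) : K) * ((t : ↥T) : K) = 1 := by
        have := congrArg (fun z : ↥T => (z : K)) (u.inv_mul)
        simpa [hu] using this
      rw [← eq_inv_of_mul_eq_one_left h1]
      exact ((u⁻¹ : (↥T)ˣ) : ↥T).2
    have hres_t : residue W ⟨((t : ↥T) : K), hTW _ t.2⟩ ≠ 0 :=
      residue_ne_zero_of_inv_mem W (hTW _ t.2) (hTW _ htinv) ht0K
    have e : residue W ⟨s, hTW s hs⟩ =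
        residue W ⟨(((⟨s, hs⟩ : ↥T) * t : ↥T) : K), hTW _ ((⟨s, hs⟩ : ↥T) * t).2⟩ *
          (residue W ⟨((t : ↥T) : K), hTW _ t.2⟩)⁻¹ := by
      rw [eq_mul_inv_iff_mul_eq₀ hres_t, ← map_mul]
      exact congrArg _ (Subtype.ext rfl)
    rw [e]
    exact (IntermediateField.adjoin k _).mul_mem (residue_mem_adjoin_of_mem_adjoin W T hTW _ hst)
      ((IntermediateField.adjoin k _).inv_mem (residue_mem_adjoin_of_mem_adjoin W T hTW _ ht))

/-- … hence the trace field is finitely generated AS A FIELD over `k`. [this work; Mathlib `fg_top`] -/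
theorem traceField_top_fg (W : ValuationSubring K) [Algebra k W] [IsScalarTower k W K]
    (T : Subalgebra k K) (hTW : ∀ x ∈ T, x ∈ W) [Algebra.EssFiniteType k ↥T] :
    (⊤ : IntermediateField k ↥(IntermediateField.adjoin k (Set.range fun x : ↥T => residue W ⟨(x : K), hTW x x.2⟩))).FG := by
  haveI : Algebra.EssFiniteType k ↥(IntermediateField.adjoin k (Set.range fun x : ↥T => residue W ⟨(x : K), hTW x x.2⟩)) :=
    IntermediateField.essFiniteType_iff.mpr (traceField_fg W T hTW)
  exact IntermediateField.fg_top k _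

/-- The trace field has transcendence degree at most that of `κ(W)`. [folklore] -/
theorem trdeg_traceField_le (W : ValuationSubring K) [Algebra k W] [IsScalarTower k W K]
    (T : Subalgebra k K) (hTW : ∀ x ∈ T, x ∈ W) :
    Algebra.trdeg k ↥(IntermediateField.adjoin k (Set.range fun x : ↥T => residue W ⟨(x : K), hTW x x.2⟩)) ≤ Algebra.trdeg k (ResidueField W) :=
  trdeg_le_of_injective (IntermediateField.adjoin k (Set.range fun x : ↥T => residue W ⟨(x : K), hTW x x.2⟩)).val (IntermediateField.adjoin k (Set.range fun x : ↥T => residue W ⟨(x : K), hTW x x.2⟩)).val.toRingHom.injective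


end Summit.ResolutionOfSingularities.ResolutionOfSingularities.Theorems.NoZeno.TraceSocle

end
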